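import Summits.NavierStokesRegularity.FluidComputer.PalasekTowerRealisationForcedRows
import Literature.Analysis.FluidPDE.LerayHopfTranslate
import HarnessLib

/-!
# THE BKM BUDGET BETWEEN TWO TIMES, WITH THE CLAY FORCE: `∫|ω(t₁)|² ≤ (∫|ω(t₀)|² + G(t₁−t₀))·
# exp(2∫_{t₀}^{t₁}‖ω‖_∞ + (t₁−t₀))` for every Clay blow-up and every tower realisation (e-fold form)

Cell `ns-blowup`, seat `ns-blowup-ecbridge-2` (g9; the E–C endpoint theory seat). LABEL: E–C typing
(KERNEL — no named fact). WHAT THIS IS NOT: not Navier–Stokes evidence — a-priori bookkeeping on the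
TYPES `ClayBlowup ν` / `Realisation ν R` (no inhabitant is claimed anywhere). Companion memo:
`run/shared/lean/pub/ns-blowup/ecbridge2/ECBRIDGE-2-MEMO-8.md`.

## Content

`ClayBlowupForcedVorticityCriteria` records the QUALITATIVE Beale–Kato–Majda row `∫₀ᵀ‖ω‖_∞ = ∞` with the
Clay force. The Literature bound behind it (`sq_norm_curl_le_of_vorticity_sup_forced`) is quantitative;
applied to the time-shifted blow-up on `[t₀, t₁] ⊂ [0, T)` it gives the BUDGET every window must pay:

* **`ClayBlowup.sq_norm_curl_le_of_vorticity_integral`** — ONE `G ≥ 0` (from the Clay force) such that for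
  all `0 ≤ t₀ < t₁ < T` with `A = ∫_{t₀}^{t₁}‖curl u‖_∞ < ∞`:
  `∫|ω(t₁)|² ≤ (∫|ω(t₀)|² + G (t₁ − t₀)) exp(2A + (t₁ − t₀))`;
* **`ClayBlowup.log_enstrophy_ratio_le_vorticity_integral`** — the e-fold reading:
  `log(∫|ω(t₁)|² / (∫|ω(t₀)|² + G(t₁−t₀))) ≤ 2A + (t₁ − t₀)`: the logarithmic growth of the vorticity
  `L²` mass over a window is paid by twice the time integral of the vorticity maximum (plus the window
  length);
* `Realisation.sq_norm_curl_le_between_readouts` — the same between any two readout times of a tower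
  realisation (RATE-TABLE currency: the e-folds `E_k` of level `k` must satisfy
  `E_k ≲ 2∫_{τ_{k−1}}^{τ_k}‖ω‖_∞ + |window|`, i.e. a vorticity ceiling `A_k` held for the window `|t_k|`
  buys at most `2A_k|t_k|` e-folds of enstrophy).

References: Beale–Kato–Majda 1984, Thm. 1 [cite: BealeKatoMajda1984, Theorem 1]; Majda–Bertozzi 2002,
(3.80)–(3.82) [cite: MajdaBertozzi2002, Thm. 3.6 proof, (3.80)-(3.82)]; S. Palasek, arXiv:2605.13827 §4
[cite: Palasek2026ElementaryModel, §4]; Fefferman (C) [cite: FeffermanClay2006, (C)].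
-/

noncomputable section

namespace Summit.NavierStokesRegularity.FluidComputer

open Set MeasureTheory Filter Topology Function Metric
open scoped ENNReal ContDiff NNReal
open Literature.Analysis.FluidPDE
open Summit.NavierStokesRegularity.NavierStokesRegularity

namespace ClayBlowup

variable {ν : ℝ} (X : ClayBlowup ν)

/-- **THE BKM BUDGET BETWEEN TWO TIMES, WITH THE CLAY FORCE** (`ν > 0`; no named fact): there is
`G ≥ 0` (the uniform `L²` bound of `curl f`) such that for all `0 ≤ t₀ < t₁ < T` with
`A = ∫_{t₀}^{t₁} ‖curl u(t)‖_{L^∞} dt < ∞`: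
`∫|curl u(t₁)|² ≤ (∫|curl u(t₀)|² + G (t₁ − t₀)) · exp(2A + (t₁ − t₀))` — the Literature bound
`sq_norm_curl_le_of_vorticity_sup_forced` on the blow-up shifted to the slab `[t₀, t₁]` (Tao class there).
[cite: BealeKatoMajda1984, Theorem 1] [cite: MajdaBertozzi2002, Thm. 3.6 proof, (3.80)-(3.82)] -/
theorem sq_norm_curl_le_of_vorticity_integral (hν : 0 < ν) :
    ∃ G : ℝ, 0 ≤ G ∧ ∀ t₀ t₁ : ℝ, 0 ≤ t₀ → t₀ < t₁ → t₁ < X.T →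
      (∫⁻ t in Ioo t₀ t₁, ⨆ x, ‖curl (X.u t) x‖ₑ) ≠ ⊤ →
      ∫ x, ‖curl (X.u t₁) x‖ ^ 2 ≤
        ((∫ x, ‖curl (X.u t₀) x‖ ^ 2) + G * (t₁ - t₀)) *
          Real.exp (2 * (∫⁻ t in Ioo t₀ t₁, ⨆ x, ‖curl (X.u t) x‖ₑ).toReal + (t₁ - t₀)) := by
  obtain ⟨G, hG⟩ := X.exists_lintegral_curl_force_sq_le
  refine ⟨G, G.coe_nonneg, fun t₀ t₁ h0 h01 h1T hA => ?_⟩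
  have hD : 0 < t₁ - t₀ := by linarith
  have ht1 : 0 < t₁ := lt_of_le_of_lt h0 h01
  -- the blow-up shifted to `[t₀, t₁]`
  have hsubI : ∀ τ ∈ Icc 0 (t₁ - t₀), τ + t₀ ∈ Icc 0 t₁ := fun τ hτ =>
    ⟨by linarith [hτ.1], by linarith [hτ.2]⟩
  have hcl : IsClassicalNSSolutionOn (Icc 0 (t₁ - t₀)) ν (fun τ => X.f (τ + t₀))
      (fun τ => X.u (τ + t₀)) (fun τ => X.p (τ + t₀)) :=
    ((X.classical_Icc ht1 h1T).comp_add_right t₀).mono (fun τ hτ => hsubI τ hτ) (uniqueDiffOn_Icc hD)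
  have hB : HasBoundedSobolevNormsOn (Icc 0 (t₁ - t₀)) (fun τ => X.u (τ + t₀)) := fun n =>
    ((X.hasBoundedSobolevNormsOn hν ht1 h1T) n).imp fun _ hC t ht => hC (t + t₀) (hsubI t ht)
  have hGs : ∀ t ∈ Icc 0 (t₁ - t₀), ∫⁻ x, ‖curl ((fun τ => X.f (τ + t₀)) t) x‖ₑ ^ 2 ≤ G :=
    fun t ht => hG (t + t₀) (by linarith [ht.1])
  -- the vorticity integral over the shifted window
  have htrans : (∫⁻ τ in Ioo 0 (t₁ - t₀), ⨆ x, ‖curl (X.u (τ + t₀)) x‖ₑ) =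
      ∫⁻ t in Ioo t₀ t₁, ⨆ x, ‖curl (X.u t) x‖ₑ := by
    have h := setLIntegral_Ioo_comp_add_right (fun t => ⨆ x, ‖curl (X.u t) x‖ₑ) 0 (t₁ - t₀) t₀
    simp only [zero_add, sub_add_cancel] at h
    exact h
  have hA' : (∫⁻ τ in Ioo 0 (t₁ - t₀), ⨆ x, ‖curl ((fun τ => X.u (τ + t₀)) τ) x‖ₑ) ≠ ⊤ := by
    show (∫⁻ τ in Ioo 0 (t₁ - t₀), ⨆ x, ‖curl (X.u (τ + t₀)) x‖ₑ) ≠ ⊤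
    rw [htrans]; exact hA
  have h := sq_norm_curl_le_of_vorticity_sup_forced hν hD hcl hB hGs hA' (t₁ - t₀) ⟨hD.le, le_rfl⟩
  have h' : ∫ x, ‖curl (X.u t₁) x‖ ^ 2 ≤
      ((∫ x, ‖curl (X.u t₀) x‖ ^ 2) + G * (t₁ - t₀)) *
        Real.exp (2 * (∫⁻ τ in Ioo 0 (t₁ - t₀), ⨆ x, ‖curl (X.u (τ + t₀)) x‖ₑ).toReal + (t₁ - t₀)) := by
    have e1 : (fun τ => X.u (τ + t₀)) (t₁ - t₀) = X.u t₁ := by simp only [sub_add_cancel]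
    have e0 : (fun τ => X.u (τ + t₀)) 0 = X.u t₀ := by simp only [zero_add]
    simpa only [e1, e0] using h
  rw [htrans] at h'
  exact h'

/-- **The e-fold reading of the BKM budget** (`ν > 0`; no named fact): with the `G` of
`sq_norm_curl_le_of_vorticity_integral`, for `0 ≤ t₀ < t₁ < T` with finite vorticity integral and
`∫|curl u(t₁)|² > 0`: `log(∫|ω(t₁)|² / (∫|ω(t₀)|² + G(t₁ − t₀))) ≤ 2∫_{t₀}^{t₁}‖curl u‖_∞ + (t₁ − t₀)`.
[cite: BealeKatoMajda1984, Theorem 1] -/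
theorem log_enstrophy_ratio_le_vorticity_integral (hν : 0 < ν) :
    ∃ G : ℝ, 0 ≤ G ∧ ∀ t₀ t₁ : ℝ, 0 ≤ t₀ → t₀ < t₁ → t₁ < X.T →
      (∫⁻ t in Ioo t₀ t₁, ⨆ x, ‖curl (X.u t) x‖ₑ) ≠ ⊤ → 0 < ∫ x, ‖curl (X.u t₁) x‖ ^ 2 →
      Real.log ((∫ x, ‖curl (X.u t₁) x‖ ^ 2) / ((∫ x, ‖curl (X.u t₀) x‖ ^ 2) + G * (t₁ - t₀))) ≤
        2 * (∫⁻ t in Ioo t₀ t₁, ⨆ x, ‖curl (X.u t) x‖ₑ).toReal + (t₁ - t₀) := by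
  obtain ⟨G, hG0, hbud⟩ := X.sq_norm_curl_le_of_vorticity_integral hν
  refine ⟨G, hG0, fun t₀ t₁ h0 h01 h1T hA hY1 => ?_⟩
  have h := hbud t₀ t₁ h0 h01 h1T hA
  set Y₁ : ℝ := ∫ x, ‖curl (X.u t₁) x‖ ^ 2 with hY₁def
  set Y₀ : ℝ := ∫ x, ‖curl (X.u t₀) x‖ ^ 2 with hY₀def
  set E : ℝ := 2 * (∫⁻ t in Ioo t₀ t₁, ⨆ x, ‖curl (X.u t) x‖ₑ).toReal + (t₁ - t₀) with hE
  have hY₀0 : 0 ≤ Y₀ := integral_nonneg fun x => sq_nonneg _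
  have hden0 : 0 ≤ Y₀ + G * (t₁ - t₀) := by nlinarith
  have hden : 0 < Y₀ + G * (t₁ - t₀) := by
    rcases hden0.eq_or_lt with hz | hpos
    · exfalso
      rw [← hz, zero_mul] at h
      linarith
    · exact hpos
  rw [Real.log_div hY1.ne' hden.ne', sub_le_iff_le_add]
  calc Real.log Y₁ ≤ Real.log ((Y₀ + G * (t₁ - t₀)) * Real.exp E) := Real.log_le_log hY1 h
    _ = E + Real.log (Y₀ + G * (t₁ - t₀)) := by
        rw [Real.log_mul hden.ne' (Real.exp_pos _).ne', Real.log_exp, add_comm]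

end ClayBlowup

/-! ## The budget between two readouts of a tower realisation -/

namespace PalasekTowerClayBridge.Realisation

variable {ν : ℝ} {R : TowerRates} (W : Realisation ν R)

/-- **The BKM budget between two readout times of a tower realisation, WITH its force** (`ν > 0`;
no named fact): ONE `G ≥ 0` with, for all `j, k` with `τ_j < τ_k` and finite `A = ∫_{τ_j}^{τ_k}‖curl u‖_∞`:
`∫|ω(τ_k)|² ≤ (∫|ω(τ_j)|² + G (τ_k − τ_j)) exp(2A + (τ_k − τ_j))` — the enstrophy e-folds of the levels
grown between the two readouts are paid by `2∫‖ω‖_∞` over that window.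
[cite: BealeKatoMajda1984, Theorem 1] [cite: Palasek2026ElementaryModel, §4] -/
theorem sq_norm_curl_le_between_readouts (hν : 0 < ν) :
    ∃ G : ℝ, 0 ≤ G ∧ ∀ j k : ℕ, W.τ j < W.τ k →
      (∫⁻ t in Ioo (W.τ j) (W.τ k), ⨆ x, ‖curl (W.u t) x‖ₑ) ≠ ⊤ →
      ∫ x, ‖curl (W.u (W.τ k)) x‖ ^ 2 ≤
        ((∫ x, ‖curl (W.u (W.τ j)) x‖ ^ 2) + G * (W.τ k - W.τ j)) *
          Real.exp (2 * (∫⁻ t in Ioo (W.τ j) (W.τ k), ⨆ x, ‖curl (W.u t) x‖ₑ).toReal +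
            (W.τ k - W.τ j)) := by
  obtain ⟨G, hG0, hbud⟩ := W.toDesignedBlowup.toClayBlowup.sq_norm_curl_le_of_vorticity_integral hν
  exact ⟨G, hG0, fun j k hjk hA => hbud (W.τ j) (W.τ k) (W.τ_mem j).1 hjk (W.τ_mem k).2 hA⟩

end PalasekTowerClayBridge.Realisation

end Summit.NavierStokesRegularity.FluidComputer

end
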